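import Summits.CriticalPhenomena.PercolationContinuityZ3.Theorems.PercAnnulusCrossingIICTwoPointUpper
import HarnessLib

/-!
# The IIC has zero density: `|Λ(n)|⁻¹ Σ_{z ∈ Λ(n)} ν(0 ↔ z) → 0` (lane RSW3, p1 gen 7)

builds on p205010 (kernel theorem, internal audit signed; external expert review pending) — through `CSH.percolationContinuity_allDimensions`
(`θ(p_c) = 0`) inside `iicMeasure_real_openConn_small_criticalProbI`.

Seat `prim-rsw3-p1` (gen 7).  Cesàro form of `PercAnnulusCrossingIICTwoPointUpper.lean`: at `p_c(ℤ^d)`, `d ≥ 2`, under (A2)□ at aspect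
`(s,L)` (`2 ≤ s ≤ L`, `ϰ > 0`), for any finite measure `ν` with Kesten's IIC limit property, the expected fraction of the box `Λ(n)` covered by
the cluster of the origin, `|Λ(n)|⁻¹ Σ_{z ∈ Λ(n)} ν(0 ↔ z) = |Λ(n)|⁻¹ E_ν|C(0) ∩ Λ(n)|`, tends to `0` — THE INCIPIENT INFINITE CLUSTER HAS ZERO
DENSITY (Kesten 1986 (1.13) in `ℤ²`: `E_ν|C(0) ∩ Λ(n)| ≍ n² π(n)`).

* `iicMeasure_cesaro_openConn_tendsto_zero_criticalProbI`.

Helper file for the crux `stmt-CriticalPhenomena-4575` chain; no definitions, no sorries.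
References: H. Kesten, PTRF 73 (1986) 369–394, (1.13) and Thm. (8); D. Basu, A. Sapozhnikov, ECP 22 (2017) no. 26, Thm. 1.1.
-/

noncomputable section

namespace Summit.CriticalPhenomena.PercolationContinuityZ3.Theorems.Crossing

open MeasureTheory ProbabilityTheory Filter Topology
open Literature.Probability.Percolation Literature.Probability.LatticeModels
open Literature.Probability.Percolation.DCT16 Literature.Probability.Percolation.DKT20
open scoped ENNReal ProbabilityTheory Literature.Probability.Percolation

variable {d : ℕ}

/-- **THE IIC HAS ZERO DENSITY (Cesàro form)**: at `p_c(ℤ^d)`, `d ≥ 2`, under (A2)□ at aspect `(s,L)` (`2 ≤ s ≤ L`, `ϰ > 0`), for every finite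
measure `ν` with Kesten's IIC limit property, `|Λ(n)|⁻¹ Σ_{z ∈ Λ(n)} ν(0 ↔ z) → 0` as `n → ∞` (split the sum at `Λ(n₀)` beyond which
`ν(0 ↔ z) ≤ ε/2`, `iicMeasure_real_openConn_small_criticalProbI`; the finitely many inner terms are `≤ ν(univ)` each and `|Λ(n)| ≥ n`).
[cite: Kesten1986, (1.13) and Thm. (8)] [cite: BasuSapozhnikov2017ECP, Thm. 1.1] -/
theorem iicMeasure_cesaro_openConn_tendsto_zero_criticalProbI (hd : 2 ≤ d) {s L : ℕ} (hs : 2 ≤ s) (hsL : s ≤ L) {ϰ : ℝ}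
    (hϰ : 0 < ϰ) (hA2 : SetToSetQuasiMultAspectAt d (criticalProbI d) s L ϰ) {ν : Measure (BondConfig (Site d))} [IsFiniteMeasure ν]
    (hν : ∀ (F : Finset (Sym2 (Site d))) (E : Set (BondConfig (Site d))), MeasurableSet E → DeterminedBy E ↑F →
      Tendsto (fun n : ℕ => (bondPercolation (zdGraph d) (criticalProbI d)).real (E ∩ siteToBoundary d n) /
        oneArmProb d (criticalProbI d) n) atTop (𝓝 (ν.real E))) :
    Tendsto (fun n : ℕ => (∑ z ∈ box d n, ν.real (openConn (0 : Site d) z)) / ((box d n).card : ℝ)) atTop (𝓝 0) := by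
  classical
  set M : ℝ := ν.real Set.univ with hM
  have hM0 : 0 ≤ M := measureReal_nonneg
  have hle : ∀ z : Site d, ν.real (openConn (0 : Site d) z) ≤ M := fun z =>
    measureReal_mono (Set.subset_univ _) (measure_ne_top _ _)
  have hcard : ∀ n : ℕ, (n : ℝ) ≤ ((box d n).card : ℝ) := by
    intro n
    rw [card_box]
    have h1 : n ≤ 2 * n + 1 := by omega
    have h2 : 2 * n + 1 ≤ (2 * n + 1) ^ d := Nat.le_self_pow (by omega) _
    exact_mod_cast h1.trans h2
  have hcard0 : ∀ n : ℕ, (0 : ℝ) < ((box d n).card : ℝ) := fun n => by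
    have : 0 < (box d n).card := Finset.card_pos.2 ⟨0, zero_mem_box d n⟩
    exact_mod_cast this
  rw [Metric.tendsto_atTop]
  intro ε hε
  obtain ⟨n₀, hn₀⟩ := iicMeasure_real_openConn_small_criticalProbI hd hs hsL hϰ hA2 hν (half_pos hε)
  -- beyond `N` the inner block `Λ(n₀)` is negligible
  obtain ⟨N, hN⟩ := exists_nat_gt (2 * (((box d n₀).card : ℝ) * M) / ε)
  refine ⟨max N 1, fun n hn => ?_⟩
  have hnN : (N : ℝ) ≤ n := by exact_mod_cast le_trans (le_max_left N 1) hn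
  have hn1 : (1 : ℝ) ≤ n := by exact_mod_cast le_trans (le_max_right N 1) hn
  rw [Real.dist_eq, sub_zero, abs_of_nonneg (div_nonneg (Finset.sum_nonneg fun z _ => measureReal_nonneg) (hcard0 n).le)]
  -- split the sum at `Λ(n₀)`
  have hsplit : ∑ z ∈ box d n, ν.real (openConn (0 : Site d) z) ≤
      ((box d n₀).card : ℝ) * M + ε / 2 * ((box d n).card : ℝ) := by
    calc ∑ z ∈ box d n, ν.real (openConn (0 : Site d) z)
        = ∑ z ∈ box d n with z ∈ box d n₀, ν.real (openConn (0 : Site d) z) +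
            ∑ z ∈ box d n with z ∉ box d n₀, ν.real (openConn (0 : Site d) z) :=
          (Finset.sum_filter_add_sum_filter_not _ _ _).symm
      _ ≤ ((box d n₀).card : ℝ) * M + ε / 2 * ((box d n).card : ℝ) := by
          refine add_le_add ?_ ?_
          · calc ∑ z ∈ box d n with z ∈ box d n₀, ν.real (openConn (0 : Site d) z)
                ≤ ∑ z ∈ box d n with z ∈ box d n₀, M := Finset.sum_le_sum fun z _ => hle z
              _ = (((box d n).filter fun z => z ∈ box d n₀).card : ℝ) * M := by rw [Finset.sum_const, nsmul_eq_mul]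
              _ ≤ ((box d n₀).card : ℝ) * M := by
                  refine mul_le_mul_of_nonneg_right ?_ hM0
                  exact_mod_cast Finset.card_le_card fun z hz => (Finset.mem_filter.1 hz).2
          · calc ∑ z ∈ box d n with z ∉ box d n₀, ν.real (openConn (0 : Site d) z)
                ≤ ∑ z ∈ box d n with z ∉ box d n₀, ε / 2 := Finset.sum_le_sum fun z hz => hn₀ z (Finset.mem_filter.1 hz).2
              _ = (((box d n).filter fun z => z ∉ box d n₀).card : ℝ) * (ε / 2) := by rw [Finset.sum_const, nsmul_eq_mul]
              _ ≤ ((box d n).card : ℝ) * (ε / 2) := by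
                  refine mul_le_mul_of_nonneg_right ?_ (half_pos hε).le
                  exact_mod_cast Finset.card_le_card (Finset.filter_subset _ _)
              _ = ε / 2 * ((box d n).card : ℝ) := by ring
  have hfirst : ((box d n₀).card : ℝ) * M / ((box d n).card : ℝ) < ε / 2 := by
    rw [div_lt_iff₀ (hcard0 n)]
    have h1 : 2 * (((box d n₀).card : ℝ) * M) / ε < n := lt_of_lt_of_le hN hnN
    rw [div_lt_iff₀ hε] at h1
    nlinarith [hcard n, hM0]
  calc (∑ z ∈ box d n, ν.real (openConn (0 : Site d) z)) / ((box d n).card : ℝ)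
      ≤ (((box d n₀).card : ℝ) * M + ε / 2 * ((box d n).card : ℝ)) / ((box d n).card : ℝ) :=
        div_le_div_of_nonneg_right hsplit (hcard0 n).le
    _ = ((box d n₀).card : ℝ) * M / ((box d n).card : ℝ) + ε / 2 := by
        rw [add_div, mul_div_cancel_right₀ _ (hcard0 n).ne']
    _ < ε / 2 + ε / 2 := by linarith
    _ = ε := by ring

end Summit.CriticalPhenomena.PercolationContinuityZ3.Theorems.Crossing

end
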